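import Literature.IUT.LogVolume.GenuineRamificationBounds
import Literature.IUT.LogVolume.GenuineLogThetaPoint
import Literature.IUT.LogVolume.LambdaLineGaloisDegree
import Literature.IUT.LogVolume.Corollary22FullGaloisImage
import HarnessLib

/-!
# [IUTchIV] Theorem 1.10, Step (iii) (R1)–(R4) AT A GENUINE Θ-VOLUME DATUM of the `λ`-line (proof-only;
# abc-iut cell, campaign S, seat abc-iut-S1)

Mochizuki, *Inter-universal Teichmüller theory IV* (RIMS manuscript Apr. 2020 = PRIMS **57** (2021)), Thm. 1.10,
p. 22: "`d_mod := [F_mod : ℚ]`, `(1 ≤) e_mod (≤ d_mod)` for the maximal ramification index of `F_mod` … `d*_mod :=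
2^12·3^3·5·d_mod`, `e*_mod := 2^12·3^3·5·e_mod`, … `F := F_mod(√−1, E_{F_mod}[2·3·5]) = F_tpd(√−1, E_{F_tpd}[3·5])`";
Step (ii), p. 24: "`Gal(F/F_tpd) ↪ GL₂(𝔽₃) × GL₂(𝔽₅) × ℤ/2ℤ`" (so `[F : F_mod] = [F : F_tpd]·[F_tpd : F_mod] ≤
46080·6 = 2^11·3^3·5`); Step (iii) (R1)–(R4), p. 25–26; Step (v), p. 28 ("`4(j+1)·ι_{v_ℚ}·l*_mod`").

The companion `GenuineRamificationBounds.lean` proves (R1)–(R4) for the genuine completions over any tower of number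
fields `F₀ ⊆ F ⊆ K` with `[F : F₀] ≤ 2^11·3^3·5`. This file instantiates the tower at a GENUINE Θ-volume datum of the
`λ`-line (abc-iut-S2's `Cor22.ThetaVolumeDatumAt P l`: a theta field `F` of `P` — abc-iut-S-d2's `IsThetaField`,
`[F : F_tpd] ∣ 46080` —, `K`, initial Θ-data `D`, and a genuine volume input `I : ThetaVolumeInput F_mod K` with
`F_mod = fieldOfModuli E_F = ℚ(j(E_F)) ⊆ F`, abc-iut-L5-t2's `fieldOfModuli`):

* `Cor22.finrank_fieldOfModuli_thetaCurve` — `[F_mod : ℚ] = d_mod` (`j(E_F) = j(λ)`, `Cor22.thetaCurve_j`, so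
  `ℚ(j(E_F)) ≅ ℚ(j(λ))`: same minimal polynomial);
* `Cor22.finrank_fieldOfModuli_thetaField_le` — **`[F : F_mod] ≤ 2^11·3^3·5`** for a theta field `F` of a point
  `P ∈ U` (`d_mod·[F : F_mod] = [F : F_tpd]·[F_tpd : ℚ] ≤ 46080·6·d_mod`, abc-iut-S3/S-d2's `degree_le_six_mul_dmod`);
* `Cor22.ramificationIdx_le_dmod` — `e(v | p) ≤ d_mod` for the places `v` of `F_mod` ("`e_mod ≤ d_mod`");
* `ramificationIdx_dvd_of_forall_places` — adapter from the per-place producers' shape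
  ("`∀ w ∤ l, ∀ Q | w, e(Q|w) ∣ l`") to the hypothesis `htame` of `PlaceSection.R4_localFieldFamily`;
* `Cor22.R4_thetaVolumeInput` — **(R4) for the genuine local fields `K_{v̲}` of a Θ-volume input over a theta
  field**, in the shape of the hypothesis `hR4` of the L-DH Step (v) file (abc-iut-c312-d1,
  `Summit.ABC.IUTFork.DHData.logμ_hullUTheta_ofInput_le_collBoundMin`), the remaining inputs being exactly the
  Prop. 1.8 (vii) / (E3) facts for the tower `F ⊆ K = F(E_F[l])` in global currency (`[K:F] ∣ l(l−1)²(l+1)`;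
  `e(v̲|v̲∩F) ∣ l` at `v̲ ∤ l`), which abc-iut-S-d1 instantiates from `D` (consumed BY NAME, not re-proved). For a
  bundled datum `T : Cor22.ThetaVolumeDatumAt P l` apply it to `(T.F, T.isThetaField, T.K, T.I)` under the usual
  `letI := T.inst…` preamble (`l` prime by `T.D.l_prime`).

Proof-only (no definition, no named fact, no instance); classical; TAKES NO SIDE on [IUTchIII] Cor. 3.12.
-/

noncomputable section

namespace Literature.IUT.LogVolume

open NumberField IsDedekindDomain Literature.IUT.HodgeTheaters
open Literature.NumberTheory.DiophantineGeometry.GenEll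

/-! ## Adapter: the per-place producers' shape ⇒ `htame` -/

/-- From "for every place `w` of `F` not over `l` and every prime `Q` of `K` over `w`, `e(Q | w) ∣ l`" (the shape of
the Prop. 1.8 (vii) instances: `e = 1` at good places, `e ∣ l` at multiplicative ones) to the hypothesis `htame` of
`PlaceSection.R4_localFieldFamily` at a prime `u` of `K`. [cite: Mochizuki2012, IUTchIV Prop 1.8 (vii) p.19] -/
theorem ramificationIdx_dvd_of_forall_places {F K : Type} [Field F] [NumberField F] [Field K] [NumberField K]
    [Algebra F K] (u : HeightOneSpectrum (𝓞 K)) {l : ℕ}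
    (H : ∀ w : HeightOneSpectrum (𝓞 F), ((l : ℕ) : 𝓞 F) ∉ w.asIdeal →
      ∀ (Q : Ideal (𝓞 K)) [Q.IsPrime] [Q.LiesOver w.asIdeal], Q.ramificationIdx (𝓞 F) ∣ l) :
    ((l : ℕ) : 𝓞 F) ∉ u.asIdeal.under (𝓞 F) → u.asIdeal.ramificationIdx (𝓞 F) ∣ l := fun hl =>
  let w : HeightOneSpectrum (𝓞 F) :=
    ⟨u.asIdeal.under (𝓞 F), Ideal.IsPrime.under (𝓞 F) u.asIdeal, mt Ideal.eq_bot_of_comap_eq_bot u.ne_bot⟩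
  haveI : u.asIdeal.LiesOver w.asIdeal := ⟨rfl⟩
  H w hl u.asIdeal

namespace Cor22

variable {P : NFPoint} (F : Type) [Field F] [NumberField F] [Algebra P.F F]

/-! ## `[F_mod : ℚ] = d_mod` and `[F : F_mod] ≤ 2^11·3^3·5` for a theta field -/

/-- The scalar tower `ℚ ⊆ F_tpd ⊆ F` (rational scalars commute with any ring map). [folklore] -/
private theorem isScalarTower_rat : IsScalarTower ℚ P.F F :=
  IsScalarTower.of_algebraMap_eq fun q => by simp

/-- **`[F_mod : ℚ] = d_mod`**: the field of moduli `ℚ(j(E_F)) ⊆ F` of the Legendre curve of `λ` over `F ⊇ F_tpd`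
has degree `d_mod = [ℚ(j(λ)) : ℚ]` (`j(E_F) = j(λ)` read in `F`, so both are generated by a root of the same minimal
polynomial). [cite: Mochizuki2012, IUTchIV Thm 1.10 p.22] -/
theorem finrank_fieldOfModuli_thetaCurve (hU : P.InU) :
    letI := thetaCurve_isElliptic hU F
    Module.finrank ℚ (fieldOfModuli (thetaCurve P F)) = dmod P := by
  letI := thetaCurve_isElliptic hU F
  haveI := isScalarTower_rat F (P := P)
  unfold fieldOfModuli dmod
  rw [IntermediateField.adjoin.finrank (Algebra.IsIntegral.isIntegral _),
    IntermediateField.adjoin.finrank (Algebra.IsIntegral.isIntegral _), thetaCurve_j F hU,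
    minpoly.algebraMap_eq (algebraMap P.F F).injective]

/-- **`[F : F_mod] ≤ 2^11·3^3·5`** for a theta field `F` of a point `P ∈ U` of the `λ`-line ([IUTchIV] Thm. 1.10
Step (ii): `[F : F_tpd] ∣ 2·48·480 = 46080` and `[F_tpd : F_mod] ≤ |GL₂(𝔽₂)| = 6`; here
`d_mod·[F : F_mod] = [F : ℚ] = [F : F_tpd]·[F_tpd : ℚ] ≤ 46080·6·d_mod`). [cite: Mochizuki2012, IUTchIV Thm 1.10 proof Step (ii) p.24] -/
theorem finrank_fieldOfModuli_thetaField_le (hP : P ∈ UP) (hF : IsThetaField P F) :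
    letI := thetaCurve_isElliptic hP.1 F
    Module.finrank (fieldOfModuli (thetaCurve P F)) F ≤ 2 ^ 11 * 3 ^ 3 * 5 := by
  letI := thetaCurve_isElliptic hP.1 F
  haveI := isScalarTower_rat F (P := P)
  set F₀ := fieldOfModuli (thetaCurve P F) with hF₀
  have h1 : Module.finrank ℚ F = Module.finrank ℚ F₀ * Module.finrank F₀ F :=
    (Module.finrank_mul_finrank ℚ F₀ F).symm
  have h2 : Module.finrank ℚ F = Module.finrank ℚ P.F * Module.finrank P.F F :=
    (Module.finrank_mul_finrank ℚ P.F F).symm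
  have h3 : Module.finrank ℚ F₀ = dmod P := finrank_fieldOfModuli_thetaCurve F hP.1
  have h4 : Module.finrank ℚ P.F ≤ 6 * dmod P := degree_le_six_mul_dmod P hP
  have h5 : Module.finrank P.F F ≤ 46080 := Nat.le_of_dvd (by norm_num) hF.finrank_dvd
  have hd : 0 < dmod P := by
    rw [← h3]; exact Module.finrank_pos
  have key : dmod P * Module.finrank F₀ F ≤ dmod P * (2 ^ 11 * 3 ^ 3 * 5) := by
    calc dmod P * Module.finrank F₀ F = Module.finrank ℚ P.F * Module.finrank P.F F := by rw [← h3, ← h1, h2]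
      _ ≤ 6 * dmod P * 46080 := Nat.mul_le_mul h4 h5
      _ = dmod P * (2 ^ 11 * 3 ^ 3 * 5) := by ring
  exact Nat.le_of_mul_le_mul_left key hd

/-- **"`e_mod ≤ d_mod`"**: every ramification index of `F_mod = ℚ(j(E_F))` over `ℚ` is `≤ d_mod` — so `e_mod := d_mod`
is an admissible value in `R4_thetaVolumeInput`. [cite: Mochizuki2012, IUTchIV Thm 1.10 p.22] -/
theorem ramificationIdx_le_dmod (hU : P.InU) :
    letI := thetaCurve_isElliptic hU F
    ∀ v : HeightOneSpectrum (𝓞 (fieldOfModuli (thetaCurve P F))), v.asIdeal.ramificationIdx ℤ ≤ dmod P := by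
  letI := thetaCurve_isElliptic hU F
  intro v
  rw [← finrank_fieldOfModuli_thetaCurve F hU]
  exact ramificationIdx_int_le_finrank_rat v

/-! ## (R4) at a genuine Θ-volume input / datum -/

/-- **(R4) for the genuine local fields of a Θ-volume input over a theta field** ([IUTchIV] Thm. 1.10 Step (iii)
(R4) / Step (v) "`4(j+1)·ι_{v_ℚ}·l*_mod`"): for `P ∈ U`, a theta field `F` of `P`, a number field `K ⊇ F`, a genuine
input `I : ThetaVolumeInput F_mod K` (`F_mod = ℚ(j(E_F))`), `e_mod ≥ 1` dominating the ramification indices of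
`F_mod` over `p`, a prime `l` with `[K : F] ∣ l(l−1)²(l+1)` and the Prop. 1.8 (vii) input at the places `v̲ = I.σ.lift v`
not over `l` — the hypothesis `hR4` of the L-DH Step (v) file holds at every `v ∈ V(F_mod)_p`, with
`ι_p = (p ≤ e*_mod·l ? 1 : 0)`, `l*_mod = log(e*_mod·l)`, `e*_mod = 2^12·3^3·5·e_mod`.
[cite: Mochizuki2012, IUTchIV Thm 1.10 proof Step (iii) (R4) p.26] [cite: Mochizuki2012, IUTchIV Thm 1.10 proof Step (v) p.28] -/
theorem R4_thetaVolumeInput (hP : P ∈ UP) (hF : IsThetaField P F) {K : Type} [Field K] [NumberField K]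
    [Algebra F K]
    (I : letI := thetaCurve_isElliptic hP.1 F; ThetaVolumeInput (fieldOfModuli (thetaCurve P F)) K)
    {p : ℕ} [hp : Fact p.Prime] {emod l : ℕ} (hemod1 : 1 ≤ emod)
    (hemod : letI := thetaCurve_isElliptic hP.1 F
      ∀ v : placesOver (fieldOfModuli (thetaCurve P F)) p, v.1.asIdeal.ramificationIdx ℤ ≤ emod)
    (hl : l.Prime) (hKF : Module.finrank F K ∣ l * (l - 1) ^ 2 * (l + 1))
    (htame : letI := thetaCurve_isElliptic hP.1 F
      ∀ v : placesOver (fieldOfModuli (thetaCurve P F)) p,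
        ((l : ℕ) : 𝓞 F) ∉ (I.σ.lift v.1).asIdeal.under (𝓞 F) → (I.σ.lift v.1).asIdeal.ramificationIdx (𝓞 F) ∣ l) :
    letI := thetaCurve_isElliptic hP.1 F
    ∀ v : placesOver (fieldOfModuli (thetaCurve P F)) p,
      p - 2 < absRamificationIdx p ((I.σ.localFieldFamily p hp.out).k v) →
        3 + Real.log (absRamificationIdx p ((I.σ.localFieldFamily p hp.out).k v)) ≤
          4 * (if p ≤ 2 ^ 12 * 3 ^ 3 * 5 * emod * l then (1 : ℝ) else 0) *
            Real.log (((2 ^ 12 * 3 ^ 3 * 5 * emod : ℕ) : ℝ) * l) := by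
  letI := thetaCurve_isElliptic hP.1 F
  intro v
  exact I.σ.R4_localFieldFamily (F := F) v hemod1 (hemod v) (finrank_fieldOfModuli_thetaField_le F hP hF) hl
    hKF (htame v)


end Cor22

end Literature.IUT.LogVolume

end
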